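import Summits.Ventures.DiscreteObjects.PP12.OrderElevenTriangleKernel
import Summits.Ventures.DiscreteObjects.PP12.OrderElevenTriangleTableA
import Summits.Ventures.DiscreteObjects.PP12.OrderElevenTriangleRowsB

/-!
# PP(12), order-11 cell, Case B (`NoTriangleData12`): kernel RUNS — walker equations, part C (designs g23)
Framing: lottery ticket; floor = certified bounds/negative ranges.

Cell pub-namedobj (venture DiscreteObjects), target (M). The partition walker reproduces the literal table `PARTS` and the label walker reproduces the literal candidate-row tables `ROWSk` of the orbit representatives `REPS[k]` (this part: `k = 7, 8, 9, 10`).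
Every declaration is closed by `decide +kernel` (kernel shape measured by designs g23: a row walk ≈ 40 s, a scan slice ≤ 5 s, a φ-walk slice ≈ 3 s).
Exact Python mirror of every function and table: pub-namedobj-designs-g23/code/caseB/tri12k.py (all statements below are `True` there too).
No `sorry`, no axioms beyond the standard three; nothing here asserts a census statement by itself.
-/

namespace Summit.Ventures.DiscreteObjects.PP12

namespace Triangle12

set_option maxHeartbeats 400000000 in
/-- the candidate rows of representative `7` (`φ = 0x12457a36890`, 132 rows) are exactly `ROWS7` -/
theorem rows_eq_7 : rowsFrom 0x12457a36890 PARTS = ROWS7 := by decide +kernel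

set_option maxHeartbeats 400000000 in
/-- the candidate rows of representative `8` (`φ = 0x13625974a80`, 142 rows) are exactly `ROWS8` -/
theorem rows_eq_8 : rowsFrom 0x13625974a80 PARTS = ROWS8 := by decide +kernel

set_option maxHeartbeats 400000000 in
/-- the candidate rows of representative `9` (`φ = 0x135a7429680`, 106 rows) are exactly `ROWS9` -/
theorem rows_eq_9 : rowsFrom 0x135a7429680 PARTS = ROWS9 := by decide +kernel

set_option maxHeartbeats 400000000 in
/-- the candidate rows of representative `10` (`φ = 0x2468a135790`, 286 rows) are exactly `ROWS10` -/
theorem rows_eq_10 : rowsFrom 0x2468a135790 PARTS = ROWS10 := by decide +kernel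

end Triangle12

end Summit.Ventures.DiscreteObjects.PP12
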